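import Mathlib
import Summits.NavierStokesRegularity.NavierStokesRegularity.Theorems.LerayQuarterDissipationFiniteDissipationLiouvilleWindowRecurrence
import Summits.NavierStokesRegularity.NavierStokesRegularity.Theorems.LerayQuarterDissipationFiniteDissipationLiouvilleLocalBalanceStretchingEventual
import HarnessLib

/-!
# Crux `FiniteDissipationLiouville` (stmt-NavierStokesRegularity-22144): THE VORTEX-STRETCHING EXCESS
# RECURS WITH BOUNDED GAPS AND FILLS A DEFINITE PARABOLIC VOLUME

Theorems file of route `LerayQuarterDissipation` (lead prover g19; `--supports` the crux; second set of
instances of `…WindowSocket`, after `…WindowRecurrence`). Navier–Stokes regularity is NOT proved by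
anything here; no summit is.

Two more apex criteria of lead g18 go through the window socket — this file: the stretching form;
the sequel `…WindowRecurrenceProduction`: the critical-production rows (listed here for orientation):

* the STRETCHING-FORM local enstrophy balance `⟪ω, ∇u ω⟫ ≤ |∇ω|²_F + ‖ω‖²/(4(−t))` on the enveloped
  class (`…LocalBalance.not_singular_of_stretchingBalance_near_apex`): **`stretching_excess_in_every_window`**
  (∃ ε(A) ∈ (0,1): every singular enveloped member has in every window `[−c², −εc²]` a point where
  vortex stretching beats local palinstrophy plus the scaling quarter, `|∇ω|²_F + ‖ω‖²/(4(−t)) < ⟪ω, ∇u ω⟫`)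
  and **`stretching_excess_volume`** (∃ ε(A), η(A) > 0: the excess set meets `[−1,−ε] × ℝ³` in volume `≥ η`);
* the CRITICAL-PRODUCTION rows in the crux's own frame (KNSS-gauge Type-I + the dissipation law, NO
  envelope): with a palinstrophy credit `a < 1` (`…CriticalProduction.not_singular_of_critProdCredit_near_apex`)
  — **`critProd_excess_in_every_window`** / **`critProd_excess_volume`** (∃ ε(C,K,a), η(C,K,a): in every
  window a point, indeed a set of definite volume, where `‖ω‖² < (−t)(⟪ω, ∇u ω⟫ − a|∇ω|²_F)`); and the
  BORDERLINE `a = 1` (`…CriticalProduction.not_singular_of_enstrophy_subsolution_near_apex`, lead g18's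
  T59) — **`superCaloric_in_every_window`** / **`superCaloric_volume`**: for every singular member of
  `𝒟_{C,K}` the scale-invariant enstrophy density `t²‖ω‖²` is STRICTLY SUPER-CALORIC,
  `‖ω‖² < (−t)(⟪ω, ∇u ω⟫ − |∇ω|²_F)` (i.e. `(∂ₜ + u·∇ − Δ)(t²‖ω‖²) > 0`), on a set of definite volume
  in EVERY backward window — bounded gaps in log-time, every scale.

Bookkeeping: pointwise scale covariance (`stretchingBalance_at_nsRescale`, `critProd_at_nsRescale`),
convergence of the second-order jet `(ω, ∇u ω, ∇ω)` at a point along KNSS limits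
(`tendsto_clm_apply_of_tendsto`, `…EndpointScheme.tendsto_fderiv_curl_of_unif`), violations pass to the
approximants, violation sets are open (joint continuity of `∇u`, `∇ω` on the open past).

HONEST FRAMING. Compactness corollaries (ineffective constants) of g18's apex criteria, about a
HYPOTHETICAL singular profile; the borderline clause is a necessary condition on every singular
member of the stratum `𝒟` (in particular on the critical element of the crux). Nothing is removed
from the DSS wall (`∀ c>1 TypeIDSSLiouville c`, NECESSARY for the crux). Nothing here bears on NS
regularity.

References: Koch–Nadirashvili–Seregin–Šverák, Acta Math. 203 (2009) §4; folklore.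
-/

noncomputable section

set_option linter.dupNamespace false

namespace Summit.NavierStokesRegularity.NavierStokesRegularity.Theorems.FiniteDissipationLiouville.WindowRecurrence

open MeasureTheory Set Filter Topology Metric InnerProductSpace Function Real
open scoped RealInnerProductSpace ContDiff ENNReal
open Literature.Analysis Literature.Analysis.FluidPDE
open Summit.NavierStokesRegularity.ForcedUniquenessCountableJunk (frobeniusNormSq_smul)
open Summit.NavierStokesRegularity.NavierStokesRegularity.Theorems
open Summit.NavierStokesRegularity.NavierStokesRegularity.Theorems.RecurrentReductionD
open Summit.NavierStokesRegularity.NavierStokesRegularity.Theorems.FiniteDissipationLiouville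
open Summit.NavierStokesRegularity.NavierStokesRegularity.Theorems.FiniteDissipationLiouville.CrossFlow
open Summit.NavierStokesRegularity.NavierStokesRegularity.Theorems.FiniteDissipationLiouville.EndpointScheme
open Summit.NavierStokesRegularity.NavierStokesRegularity.Theorems.FiniteDissipationLiouville.LambProduct
open Summit.NavierStokesRegularity.NavierStokesRegularity.Theorems.FiniteDissipationLiouville.LocalBalance
open Summit.NavierStokesRegularity.NavierStokesRegularity.Theorems.FiniteDissipationLiouville.WindowSocket

variable {C : ℝ} {V : ℝ → EuclideanSpace ℝ (Fin 3) → EuclideanSpace ℝ (Fin 3)}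

/-! ### The second-order jet at a point: continuity and limits -/

section Jet

/-- `(t,x) ↦ ∇u(t,x)` is jointly continuous on the open past. [folklore] -/
theorem continuousOn_fderiv (hV : IsTypeIAncientMild C V) :
    ContinuousOn (fun p : ℝ × EuclideanSpace ℝ (Fin 3) => fderiv ℝ (V p.1) p.2) (Iio 0 ×ˢ univ) := by
  have h : IsSmoothSpaceTimeOn (Iio 0) V := hV.contDiffOn
  exact h.continuousOn_fderiv_slice isOpen_Iio.uniqueDiffOn

/-- `(t,x) ↦ ∇ω(t,x)` is jointly continuous on the open past. [folklore] -/
theorem continuousOn_fderiv_curl (hV : IsTypeIAncientMild C V) :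
    ContinuousOn (fun p : ℝ × EuclideanSpace ℝ (Fin 3) => fderiv ℝ (curl (V p.1)) p.2) (Iio 0 ×ˢ univ) :=
  (isSmoothSpaceTimeOn_curl hV).continuousOn_fderiv_slice isOpen_Iio.uniqueDiffOn

/-- Joint continuity of evaluation: `L_j → L`, `b_j → b` give `L_j b_j → L b`. [folklore] -/
theorem tendsto_clm_apply_of_tendsto
    {L : ℕ → (EuclideanSpace ℝ (Fin 3) →L[ℝ] EuclideanSpace ℝ (Fin 3))}
    {L₀ : EuclideanSpace ℝ (Fin 3) →L[ℝ] EuclideanSpace ℝ (Fin 3)}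
    {b : ℕ → EuclideanSpace ℝ (Fin 3)} {b₀ : EuclideanSpace ℝ (Fin 3)}
    (hL : Tendsto L atTop (𝓝 L₀)) (hb : Tendsto b atTop (𝓝 b₀)) :
    Tendsto (fun j => L j (b j)) atTop (𝓝 (L₀ b₀)) := by
  have hc : Continuous fun p : (EuclideanSpace ℝ (Fin 3) →L[ℝ] EuclideanSpace ℝ (Fin 3)) ×
      EuclideanSpace ℝ (Fin 3) => p.1 p.2 := isBoundedBilinearMap_apply.continuous
  exact (hc.tendsto (L₀, b₀)).comp (hL.prodMk_nhds hb)

/-- Joint continuity of evaluation on a set. [folklore] -/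
theorem continuousOn_clm_apply {S : Set (ℝ × EuclideanSpace ℝ (Fin 3))}
    {L : ℝ × EuclideanSpace ℝ (Fin 3) → (EuclideanSpace ℝ (Fin 3) →L[ℝ] EuclideanSpace ℝ (Fin 3))}
    {b : ℝ × EuclideanSpace ℝ (Fin 3) → EuclideanSpace ℝ (Fin 3)}
    (hL : ContinuousOn L S) (hb : ContinuousOn b S) : ContinuousOn (fun p => L p (b p)) S := by
  have hc : Continuous fun p : (EuclideanSpace ℝ (Fin 3) →L[ℝ] EuclideanSpace ℝ (Fin 3)) ×
      EuclideanSpace ℝ (Fin 3) => p.1 p.2 := isBoundedBilinearMap_apply.continuous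
  exact hc.comp_continuousOn (hL.prodMk hb)

end Jet

/-! ### The stretching-form balance -/

section Stretching

/-- **Pointwise scale covariance of the stretching-form balance.** [folklore] -/
theorem stretchingBalance_at_nsRescale (V : ℝ → EuclideanSpace ℝ (Fin 3) → EuclideanSpace ℝ (Fin 3))
    {c t : ℝ} (x : EuclideanSpace ℝ (Fin 3)) (hc : 0 < c) (ht : t < 0)
    (h : ⟪curl (V (c ^ 2 * t)) (c • x), fderiv ℝ (V (c ^ 2 * t)) (c • x) (curl (V (c ^ 2 * t)) (c • x))⟫ ≤
      frobeniusNormSq (fderiv ℝ (curl (V (c ^ 2 * t))) (c • x)) +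
        ‖curl (V (c ^ 2 * t)) (c • x)‖ ^ 2 / (4 * (-(c ^ 2 * t)))) :
    ⟪curl (nsRescale c V t) x, fderiv ℝ (nsRescale c V t) x (curl (nsRescale c V t) x)⟫ ≤
      frobeniusNormSq (fderiv ℝ (curl (nsRescale c V t)) x) + ‖curl (nsRescale c V t) x‖ ^ 2 / (4 * (-t)) := by
  -- adapted from `…LocalBalanceStretchingTools.stretchingBalance_nsRescale` (pointwise form)
  have hcurl : curl (nsRescale c V t) x = (c * c) • curl (V (c ^ 2 * t)) (c • x) := by
    rw [curl_eq_curlCLM, fderiv_nsRescale, map_smul, ← curl_eq_curlCLM]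
  rw [hcurl, fderiv_nsRescale, fderiv_curl_nsRescale, frobeniusNormSq_smul,
    _root_.smul_apply, map_smul, real_inner_smul_left,
    real_inner_smul_right, real_inner_smul_right, norm_smul,
    Real.norm_of_nonneg (by positivity : (0:ℝ) ≤ c * c)]
  have ht' : 0 < -t := neg_pos.2 ht
  have h4 : (4 : ℝ) * (-t) ≠ 0 := by positivity
  have h4c : (4 : ℝ) * (-(c ^ 2 * t)) ≠ 0 := by
    rw [show (4 : ℝ) * (-(c ^ 2 * t)) = c ^ 2 * (4 * (-t)) by ring]; positivity
  have e1 : (c * c * ‖curl (V (c ^ 2 * t)) (c • x)‖) ^ 2 / (4 * (-t)) =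
      c ^ 6 * (‖curl (V (c ^ 2 * t)) (c • x)‖ ^ 2 / (4 * (-(c ^ 2 * t)))) := by
    rw [mul_div_assoc', div_eq_div_iff h4 h4c]
    ring
  rw [e1]
  have hw : 0 ≤ c ^ 6 := by positivity
  calc c * c * (c * c * (c * c *
        ⟪curl (V (c ^ 2 * t)) (c • x), fderiv ℝ (V (c ^ 2 * t)) (c • x) (curl (V (c ^ 2 * t)) (c • x))⟫))
      = c ^ 6 * ⟪curl (V (c ^ 2 * t)) (c • x),
          fderiv ℝ (V (c ^ 2 * t)) (c • x) (curl (V (c ^ 2 * t)) (c • x))⟫ := by ring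
    _ ≤ c ^ 6 * (frobeniusNormSq (fderiv ℝ (curl (V (c ^ 2 * t))) (c • x)) +
          ‖curl (V (c ^ 2 * t)) (c • x)‖ ^ 2 / (4 * (-(c ^ 2 * t)))) :=
        mul_le_mul_of_nonneg_left h hw
    _ = (c * c * c) ^ 2 * frobeniusNormSq (fderiv ℝ (curl (V (c ^ 2 * t))) (c • x)) +
          c ^ 6 * (‖curl (V (c ^ 2 * t)) (c • x)‖ ^ 2 / (4 * (-(c ^ 2 * t)))) := by ring

/-- **Violations of the stretching balance pass from KNSS limits to the approximants.**
[cite: KochNadirashviliSereginSverak2009, Prop. 4.1 (arXiv:0709.3599 p. 8)] -/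
theorem stretchingBalance_violation_eventually {v : ℕ → ℝ → EuclideanSpace ℝ (Fin 3) → EuclideanSpace ℝ (Fin 3)}
    {W : ℝ → EuclideanSpace ℝ (Fin 3) → EuclideanSpace ℝ (Fin 3)}
    (hv : ∀ j, IsTypeIAncientMild C (v j)) (hW : IsTypeIAncientMild C W)
    (hunif : ∀ n : ℕ, TendstoUniformlyOn (fun j z => v j z.1 z.2) (fun z => W z.1 z.2) atTop
      (Icc (-((n : ℝ) + 2)) (-(1 / ((n : ℝ) + 2))) ×ˢ
        closedBall (0 : EuclideanSpace ℝ (Fin 3)) ((n : ℝ) + 2)))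
    (hgr : ∀ t < 0, ∀ x, Tendsto (fun j => fderiv ℝ (v j t) x) atTop (𝓝 (fderiv ℝ (W t) x)))
    {t : ℝ} (ht : t < 0) (x : EuclideanSpace ℝ (Fin 3))
    (hbad : ¬ ⟪curl (W t) x, fderiv ℝ (W t) x (curl (W t) x)⟫ ≤
      frobeniusNormSq (fderiv ℝ (curl (W t)) x) + ‖curl (W t) x‖ ^ 2 / (4 * (-t))) :
    ∀ᶠ j in atTop, ¬ ⟪curl (v j t) x, fderiv ℝ (v j t) x (curl (v j t) x)⟫ ≤
      frobeniusNormSq (fderiv ℝ (curl (v j t)) x) + ‖curl (v j t) x‖ ^ 2 / (4 * (-t)) := by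
  have htb : Tendsto (fun j => curl (v j t) x) atTop (𝓝 (curl (W t) x)) :=
    tendsto_curl_of_fderiv (hgr t ht x)
  have htG : Tendsto (fun j => fderiv ℝ (curl (v j t)) x) atTop (𝓝 (fderiv ℝ (curl (W t)) x)) :=
    tendsto_fderiv_curl_of_unif hv hW hunif ht x
  have hLb : Tendsto (fun j => fderiv ℝ (v j t) x (curl (v j t) x)) atTop
      (𝓝 (fderiv ℝ (W t) x (curl (W t) x))) := tendsto_clm_apply_of_tendsto (hgr t ht x) htb
  have hL : Tendsto (fun j => ⟪curl (v j t) x, fderiv ℝ (v j t) x (curl (v j t) x)⟫) atTop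
      (𝓝 ⟪curl (W t) x, fderiv ℝ (W t) x (curl (W t) x)⟫) := htb.inner hLb
  have hR : Tendsto (fun j => frobeniusNormSq (fderiv ℝ (curl (v j t)) x) +
      ‖curl (v j t) x‖ ^ 2 / (4 * (-t))) atTop
      (𝓝 (frobeniusNormSq (fderiv ℝ (curl (W t)) x) + ‖curl (W t) x‖ ^ 2 / (4 * (-t)))) :=
    ((continuous_frobeniusNormSq'.tendsto _).comp htG).add ((htb.norm.pow 2).div_const _)
  rw [not_le] at hbad
  filter_upwards [hR.eventually_lt hL hbad] with j hj
  exact not_le.2 hj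

/-- **The violation set of the stretching balance is open.** [folklore] -/
theorem isOpen_stretchingBalance_violation (hV : IsTypeIAncientMild C V) :
    IsOpen {p : ℝ × EuclideanSpace ℝ (Fin 3) | p.1 < 0 ∧
      ¬ ⟪curl (V p.1) p.2, fderiv ℝ (V p.1) p.2 (curl (V p.1) p.2)⟫ ≤
        frobeniusNormSq (fderiv ℝ (curl (V p.1)) p.2) + ‖curl (V p.1) p.2‖ ^ 2 / (4 * (-p.1))} := by
  have hS : IsOpen (Iio (0:ℝ) ×ˢ (univ : Set (EuclideanSpace ℝ (Fin 3)))) :=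
    isOpen_Iio.prod isOpen_univ
  have hb := continuousOn_curl hV
  have hD := continuousOn_fderiv hV
  have hG := continuousOn_fderiv_curl hV
  have hL : ContinuousOn (fun p : ℝ × EuclideanSpace ℝ (Fin 3) =>
      ⟪curl (V p.1) p.2, fderiv ℝ (V p.1) p.2 (curl (V p.1) p.2)⟫) (Iio 0 ×ˢ univ) :=
    hb.inner (continuousOn_clm_apply hD hb)
  have ht : ContinuousOn (fun p : ℝ × EuclideanSpace ℝ (Fin 3) => 4 * (-p.1)) (Iio 0 ×ˢ univ) :=
    (continuous_const.mul continuous_fst.neg).continuousOn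
  have hR : ContinuousOn (fun p : ℝ × EuclideanSpace ℝ (Fin 3) =>
      frobeniusNormSq (fderiv ℝ (curl (V p.1)) p.2) + ‖curl (V p.1) p.2‖ ^ 2 / (4 * (-p.1)))
      (Iio 0 ×ˢ univ) := by
    refine (continuous_frobeniusNormSq'.comp_continuousOn hG).add ((hb.norm.pow 2).div ht fun p hp => ?_)
    have : p.1 < 0 := hp.1
    exact mul_ne_zero four_ne_zero (neg_ne_zero.2 this.ne)
  have hO := (hL.sub hR).isOpen_inter_preimage hS (isOpen_Ioi (a := (0:ℝ)))
  convert hO using 1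
  ext p
  simp only [mem_setOf_eq, mem_inter_iff, mem_prod, mem_Iio, mem_univ, and_true, mem_preimage,
    mem_Ioi, Pi.sub_apply, sub_pos, not_le]

/-- **THE VORTEX-STRETCHING EXCESS RECURS WITH BOUNDED GAPS.** For every `A` there is
`ε = ε(A) ∈ (0,1)` such that every SINGULAR KNSS-gauge Type-I field (`IsTypeIAncientMild C V`,
`C ≤ A`) with a Type-I envelope `HasTypeIDecay A V` has in every window `[−c², −εc²]`, `c > 0`, a
point with `|∇ω|²_F + ‖ω‖²/(4(−t)) < ⟪ω, ∇V ω⟫`. [folklore energy method + KNSS compactness;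
cite: KochNadirashviliSereginSverak2009, §4 (arXiv:0709.3599 p. 8)] -/
theorem stretching_excess_in_every_window (A : ℝ) : ∃ ε : ℝ, 0 < ε ∧ ε < 1 ∧
    ∀ (C : ℝ) (V : ℝ → EuclideanSpace ℝ (Fin 3) → EuclideanSpace ℝ (Fin 3)),
      IsTypeIAncientMild C V → C ≤ A → HasTypeIDecay A V →
      (∀ r > 0, ∀ M : ℝ, ∃ t ∈ Ioo (-(r ^ 2)) (0 : ℝ),
        ∃ x ∈ ball (0 : EuclideanSpace ℝ (Fin 3)) r, M < ‖V t x‖) →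
      ∀ c : ℝ, 0 < c → ∃ t ∈ Icc (-c ^ 2) (-(ε * c ^ 2)), ∃ x : EuclideanSpace ℝ (Fin 3),
        frobeniusNormSq (fderiv ℝ (curl (V t)) x) + ‖curl (V t) x‖ ^ 2 / (4 * (-t)) <
          ⟪curl (V t) x, fderiv ℝ (V t) x (curl (V t) x)⟫ := by
  obtain ⟨ε, hε, hε1, h⟩ := exists_window_of_apex_kill_envelope (C := A)
    (G := fun F t x => ⟪curl (F t) x, fderiv ℝ (F t) x (curl (F t) x)⟫ ≤
      frobeniusNormSq (fderiv ℝ (curl (F t)) x) + ‖curl (F t) x‖ ^ 2 / (4 * (-t)))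
    (fun F c t x hc ht hG => stretchingBalance_at_nsRescale F x hc ht hG)
    (fun u W hu hW hunif hpt hgr t ht x hbad =>
      stretchingBalance_violation_eventually hu hW hunif hgr ht x hbad)
    (fun W hW hdW hG => not_singular_of_stretchingBalance_near_apex hW hdW (τ := -1/2) (by norm_num)
      fun t h1 h2 x => hG t (by linarith) h2 x)
  refine ⟨ε, hε, hε1, fun C V hV hCA hdec hsing c hc => ?_⟩
  obtain ⟨t, ht, x, hx⟩ := h V (isTypeIAncientMild_of_le hV hCA) hdec hsing c hc
  exact ⟨t, ht, x, not_le.1 hx⟩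

/-- **THE VORTEX-STRETCHING EXCESS FILLS A DEFINITE PARABOLIC VOLUME.** For every `A` there are
`ε(A) ∈ (0,1)`, `η(A) > 0` such that for every singular enveloped member the set of
`(t,x) ∈ [−1,−ε] × ℝ³` with `|∇ω|²_F + ‖ω‖²/(4(−t)) < ⟪ω, ∇V ω⟫` has volume `≥ η`.
[folklore energy method + KNSS compactness; cite: KochNadirashviliSereginSverak2009, §4 (arXiv:0709.3599 p. 8)] -/
theorem stretching_excess_volume (A : ℝ) : ∃ ε : ℝ, 0 < ε ∧ ε < 1 ∧ ∃ η : ℝ, 0 < η ∧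
    ∀ (C : ℝ) (V : ℝ → EuclideanSpace ℝ (Fin 3) → EuclideanSpace ℝ (Fin 3)),
      IsTypeIAncientMild C V → C ≤ A → HasTypeIDecay A V →
      (∀ r > 0, ∀ M : ℝ, ∃ t ∈ Ioo (-(r ^ 2)) (0 : ℝ),
        ∃ x ∈ ball (0 : EuclideanSpace ℝ (Fin 3)) r, M < ‖V t x‖) →
      ENNReal.ofReal η ≤ volume {p : ℝ × EuclideanSpace ℝ (Fin 3) | p.1 ∈ Icc (-1 : ℝ) (-ε) ∧
        frobeniusNormSq (fderiv ℝ (curl (V p.1)) p.2) + ‖curl (V p.1) p.2‖ ^ 2 / (4 * (-p.1)) <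
          ⟪curl (V p.1) p.2, fderiv ℝ (V p.1) p.2 (curl (V p.1) p.2)⟫} := by
  obtain ⟨ε, hε, hε1, η, hη, h⟩ := exists_window_volume_of_apex_kill_envelope (C := A)
    (G := fun F t x => ⟪curl (F t) x, fderiv ℝ (F t) x (curl (F t) x)⟫ ≤
      frobeniusNormSq (fderiv ℝ (curl (F t)) x) + ‖curl (F t) x‖ ^ 2 / (4 * (-t)))
    (fun u W hu hW hunif hpt hgr t ht x hbad =>
      stretchingBalance_violation_eventually hu hW hunif hgr ht x hbad)
    (fun U hU _ => isOpen_stretchingBalance_violation hU)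
    (fun W hW hdW hG => not_singular_of_stretchingBalance_near_apex hW hdW (τ := -1/2) (by norm_num)
      fun t h1 h2 x => hG t (by linarith) h2 x)
  refine ⟨ε, hε, hε1, η, hη, fun C V hV hCA hdec hsing => ?_⟩
  exact (h V (isTypeIAncientMild_of_le hV hCA) hdec hsing).trans
    (measure_mono fun p hp => ⟨hp.1, not_le.1 hp.2⟩)

end Stretching

end Summit.NavierStokesRegularity.NavierStokesRegularity.Theorems.FiniteDissipationLiouville.WindowRecurrence

end
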